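import Summits.BirchSwinnertonDyer.Rank1Residual.GaloisImage.KolyvaginScalarTransportLocal
import Summits.BirchSwinnertonDyer.Rank1Residual.GaloisImage.TorsionReductionOfLe
import Summits.BirchSwinnertonDyer.Rank1Residual.GaloisImage.TorsionLevelDevissageHigher
import HarnessLib

/-!
# Route `KimAtThreeKolyvagin` (rung W2), crux `ShallowEqDeepAtTorsionFree` (stmt-BirchSwinnertonDyer-19077):
# the STUB at the empty level from ORDERS — algebra, the cartesian property of `𝓕_can` between two
# prime-power levels, and a class of FULL order in `H¹_{𝓕_can}(ℚ, E[3^{k+1}])` from a deeper class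

Cell `bsd-addord`, seat `bsd-addord-w2-c4` (D-0074 row B7), gen 4.  TOOL theorems only (no definition, no
named fact, no `sorry`); nothing asserted about any particular curve; nothing booked; no mark moved.

WHY.  The END-OF-PORTS theorems of cruxes 19076/19077 on the Kato stratum (w2-c3
`KimAtThreeDeepUpperOfPortsDevissage.deepUpper_conclusion_of_ports_of_towerSurj`, p433736; kim3
`shallowEqDeep_conclusion_of_ports_of_deepUpper`) carry ONE inline port `hStub`: for the generator `g` of
`KS(E[3^{k+1}], 𝓕_can, 𝒫)` and `#H¹_{𝓕_can} = 3^{k+1}·3^{n₀}`, `g ∅ ∈ 3^{n₀}·H¹_{𝓕_can} + H¹_𝓚`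
(Mazur–Rubin Thm. 4.4.1 at `∅`, weakened by `+ H¹_𝓚`).  This file and its sequel
`KimAtThreeShallowEqDeepStubOfPorts` show that AT DEEP LEVELS this weakened stub needs NO new input:
* §1 `Stub.exists_eq_nsmul_add_of_addOrderOf` — pure algebra in an additive group `G` with subgroups
  `F ⊇ ⟨x⟩` (`x` of order `p^K`, `#F = p^K·p^{n₀}`), a functional `Φ : G → ℤ/p^K` whose kernel on `F`
  lies in `Kum`, an element `g ∈ F` with `p^{K−n₀} g = 0` ([S24] Thm. 4.4 (2) at `∅` in ORDER form) and
  an element `y₀ ∈ F` with `Φ y₀ = p^c·unit` (Kato's `κ_∅`: `Λ(loc κ_∅) = u·3^{t+a}`): if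
  `2n₀ + c ≤ K` then `g ∈ p^{n₀}F + Kum`.  (`#(F/⟨x⟩) = p^{n₀}` forces `p^{n₀}F ⊆ ⟨x⟩`.)
* §2 `mem_propagatedSelmerStructure_of_localMap_torsionInclusion_mem` — `𝓕_can` is CARTESIAN along
  `incl : E[p^{k+1}] ↪ E[p^{k'+1}]` at every place: `incl_* ξ ∈ 𝓕_can^{(k')}(v) ⇒ ξ ∈ 𝓕_can^{(k)}(v)`
  (n1011-p13's cocycle argument `isCartesianAt_propagatedSelmerStructure`, between two prime-power
  levels: divide the corrected Tate-module cocycle by `p^{k'−k}`).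
* §3 (`p = 3`) `isSES_torsionInclusion_red_of_le` — `0 → E[3^{k+1}] → E[3^{k'+1}] → E[3^{k'−k}] → 0`
  for `k < k'`; `exists_mem_selmerGroup_addOrderOf_eq_of_deep` — from ANY class `y ∈ H¹_{𝓕_can}(ℚ,
  E[3^{k'+1}])` of order `≥ 3^{k+1}` a class `x ∈ H¹_{𝓕_can}(ℚ, E[3^{k+1}])` of order EXACTLY `3^{k+1}`
  (under surj(3): `E(ℚ)[3] = 0`).
[cite: MazurRubin2004, Thm. 4.1.13 (i), Lemma 3.5.3, Thm. 4.4.1] [cite: Sakamoto2024, Def. 3.5 (p. 923), Thm. 4.4 (2) (p. 926)]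
[cite: Rubin2011, §3.1 (p. 29)] [cite: MilneADT2006, Ch. I §6]
-/

set_option autoImplicit false
-- the Theorems namespace of a single-conjunct summit repeats the summit name by design (D-0017)
set_option linter.dupNamespace false

noncomputable section

open scoped Classical NumberField ContRepresentation
open Function Field NumberField IsDedekindDomain WeierstrassCurve
  Literature.NumberTheory.EllipticCurves
  Literature.NumberTheory.GaloisRepresentations
  Literature.NumberTheory.GaloisRepresentations.DiscreteGaloisModule Literature.NumberTheory.GaloisCohomology
  Summit.BirchSwinnertonDyer.Rank1Residual.GaloisImage

universe u

namespace Summit.BirchSwinnertonDyer.BirchSwinnertonDyer.Theorems.KimAtThreeShallowEqDeepStubOfOrder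

/-! ## §1. Algebra: the weakened stub from orders -/

namespace Stub

/-- In `ℤ/p^K`: an element killed by `p^{n₀}` (`n₀ ≤ K`) is a multiple of `p^{K−n₀}`. [folklore] -/
theorem exists_eq_pow_mul_of_pow_smul_eq_zero (p : ℕ) [hp : Fact p.Prime] {K n₀ : ℕ} (hn : n₀ ≤ K)
    (w : ZMod (p ^ K)) (hw : p ^ n₀ • w = 0) :
    ∃ c₁ : ℕ, w = ((p ^ (K - n₀) * c₁ : ℕ) : ZMod (p ^ K)) := by
  haveI : NeZero (p ^ K) := ⟨pow_ne_zero _ hp.out.ne_zero⟩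
  have hval : (p ^ K) ∣ p ^ n₀ * w.val := by
    rw [← ZMod.natCast_eq_zero_iff, Nat.cast_mul, ZMod.natCast_zmod_val, ← nsmul_eq_mul]
    exact hw
  have hval' : p ^ n₀ * p ^ (K - n₀) ∣ p ^ n₀ * w.val := by
    rwa [← pow_add, Nat.add_sub_cancel' hn]
  obtain ⟨c₁, hc₁⟩ := Nat.dvd_of_mul_dvd_mul_left (pow_pos hp.out.pos _) hval'
  exact ⟨c₁, by rw [← hc₁, ZMod.natCast_zmod_val]⟩

/-- **The weakened STUB from orders.**  `G` an additive group, `F`, `Kum` subgroups,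
`Φ : G → ℤ/p^K` with `ker Φ ∩ F ⊆ Kum`; `#F = p^K · p^{n₀}`; `x ∈ F` of order `p^K`; `g ∈ F` with
`p^{K−n₀} g = 0`; `y₀ ∈ F` with `Φ y₀ = p^c · u₀`, `u₀` a unit; `2n₀ + c ≤ K`.  Then
`g ∈ p^{n₀} F + Kum`.  (`⟨x⟩ ≅ ℤ/p^K` has index `p^{n₀}` in `F`, so `p^{n₀} g = λ x`; `p^{K−n₀} g = 0`
forces `p^{2n₀} ∣ λ`, so `g = p^{n₀} μ x + n` with `p^{n₀} n = 0`; then `Φ n ∈ p^{K−n₀} ℤ/p^K` is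
`Φ (p^{n₀} e₂)` for a multiple `e₂` of `y₀`, and `n − p^{n₀} e₂ ∈ ker Φ ∩ F ⊆ Kum`.)  With
`F = H¹_{𝓕_can}`, `Kum = H¹_𝓚`, `Φ = Λ ∘ loc₃`, this is the `hStub` binder of the END-OF-PORTS theorem.
[cite: MazurRubin2004, Thm. 4.1.13 (i) and Thm. 4.4.1] [cite: Sakamoto2024, Thm. 4.4 (2) (p. 926)] -/
theorem exists_eq_nsmul_add_of_addOrderOf {G : Type*} [AddCommGroup G] (p : ℕ) [hp : Fact p.Prime]
    {K n₀ c : ℕ} (F Kum : AddSubgroup G) (Φ : G →+ ZMod (p ^ K))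
    (hkerΦ : ∀ y ∈ F, Φ y = 0 → y ∈ Kum)
    (hF : Nat.card F = p ^ K * p ^ n₀)
    {x : G} (hx : x ∈ F) (hxord : addOrderOf x = p ^ K)
    {g : G} (hg : g ∈ F) (hgK : p ^ (K - n₀) • g = 0)
    {y₀ : G} (hy₀ : y₀ ∈ F) (u₀ : (ZMod (p ^ K))ˣ)
    (hΦy₀ : Φ y₀ = ((p ^ c : ℕ) : ZMod (p ^ K)) * (u₀ : ZMod (p ^ K)))
    (hK : 2 * n₀ + c ≤ K) :
    ∃ e ∈ F, ∃ m ∈ Kum, g = p ^ n₀ • e + m := by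
  haveI : NeZero (p ^ K) := ⟨pow_ne_zero _ hp.out.ne_zero⟩
  have hp0 : 0 < p := hp.out.pos
  -- `F` is finite
  have hFne : Nat.card F ≠ 0 := by rw [hF]; positivity
  haveI : Finite F := Nat.finite_of_card_ne_zero hFne
  -- the cyclic subgroup `X = ⟨x⟩ ≤ F` of order `p^K` has index `p^{n₀}` in `F`
  set X : AddSubgroup G := AddSubgroup.zmultiples x with hXdef
  have hXF : X ≤ F := (AddSubgroup.zmultiples_le_of_mem hx)
  have hXcard : Nat.card X = p ^ K := by rw [hXdef, Nat.card_zmultiples, hxord]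
  set X' : AddSubgroup F := X.addSubgroupOf F with hX'def
  have hX'card : Nat.card X' = p ^ K := by
    rw [hX'def, Nat.card_congr (AddSubgroup.addSubgroupOfEquivOfLe hXF).toEquiv, hXcard]
  have hidx : X'.index = p ^ n₀ := by
    have h := X'.card_mul_index
    rw [hX'card, hF] at h
    exact Nat.eq_of_mul_eq_mul_left (pow_pos hp0 K) h
  -- hence `p^{n₀} g ∈ ⟨x⟩`: `p^{n₀} g = λ • x`
  have hmemX : p ^ n₀ • g ∈ X := by
    have h := X'.nsmul_index_mem ⟨g, hg⟩
    rw [hidx, AddSubgroup.mem_addSubgroupOf] at h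
    exact h
  obtain ⟨lam, hlam⟩ := AddSubgroup.mem_zmultiples_iff.mp hmemX
  -- `p^{K-n₀} g = 0` and `2 n₀ ≤ K` force `p^{2n₀} ∣ λ`
  have hn₀K : 2 * n₀ ≤ K := le_of_add_le_left hK
  have hzero : ((p : ℤ) ^ (K - 2 * n₀) * lam) • x = 0 := by
    rw [mul_zsmul, hlam, ← natCast_zsmul, ← mul_zsmul, ← Nat.cast_pow, ← Nat.cast_mul,
      natCast_zsmul, ← pow_add, show K - 2 * n₀ + n₀ = K - n₀ by omega, hgK]
  have hdvd : ((p : ℤ) ^ K) ∣ (p : ℤ) ^ (K - 2 * n₀) * lam := by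
    have h := (addOrderOf_dvd_iff_zsmul_eq_zero).mpr hzero
    rwa [hxord, Nat.cast_pow] at h
  have hdvd' : ((p : ℤ) ^ (2 * n₀)) ∣ lam := by
    have hsplit : ((p : ℤ) ^ K) = (p : ℤ) ^ (K - 2 * n₀) * (p : ℤ) ^ (2 * n₀) := by
      rw [← pow_add, Nat.sub_add_cancel hn₀K]
    rw [hsplit] at hdvd
    exact (mul_dvd_mul_iff_left (pow_ne_zero _ (by exact_mod_cast hp.out.ne_zero))).mp hdvd
  obtain ⟨μ, hμ⟩ := hdvd'
  -- `g = p^{n₀} e₁ + n` with `e₁ = μ x ∈ F` and `p^{n₀} n = 0`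
  set e₁ : G := μ • x with he₁
  have he₁F : e₁ ∈ F := AddSubgroup.zsmul_mem _ hx μ
  set n : G := g - p ^ n₀ • e₁ with hn
  have hnF : n ∈ F := F.sub_mem hg (F.nsmul_mem he₁F _)
  have hn0 : p ^ n₀ • n = 0 := by
    have h1 : p ^ n₀ • (p ^ n₀ • e₁) = lam • x := by
      rw [he₁, hμ, ← mul_nsmul, ← natCast_zsmul, ← mul_zsmul, Nat.cast_mul, Nat.cast_pow,
        ← pow_add, ← two_mul]
    rw [hn, nsmul_sub, h1, hlam, sub_self]
  -- `Φ n = p^{K-n₀} c₁`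
  have hn₀K : n₀ ≤ K := by omega
  have hΦn0 : p ^ n₀ • Φ n = 0 := by rw [← map_nsmul, hn0, map_zero]
  obtain ⟨c₁, hc₁⟩ := exists_eq_pow_mul_of_pow_smul_eq_zero p hn₀K (Φ n) hΦn0
  -- `e₂ = r • y₀` with `Φ (p^{n₀} e₂) = Φ n`
  set r : ℕ := p ^ (K - 2 * n₀ - c) * c₁ * ((u₀⁻¹ : (ZMod (p ^ K))ˣ) : ZMod (p ^ K)).val with hr
  set e₂ : G := r • y₀ with he₂
  have he₂F : e₂ ∈ F := F.nsmul_mem hy₀ r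
  have hΦe₂ : Φ (p ^ n₀ • e₂) = Φ n := by
    rw [he₂, map_nsmul, map_nsmul, hΦy₀, hc₁, hr, nsmul_eq_mul, nsmul_eq_mul]
    push_cast
    rw [ZMod.natCast_zmod_val]
    have hu : ((u₀⁻¹ : (ZMod (p ^ K))ˣ) : ZMod (p ^ K)) * (u₀ : ZMod (p ^ K)) = 1 := by
      rw [← Units.val_mul, inv_mul_cancel, Units.val_one]
    have hexp : n₀ + (K - 2 * n₀ - c) + c = K - n₀ := by omega
    calc ((p : ZMod (p ^ K)) ^ n₀) *
          ((p : ZMod (p ^ K)) ^ (K - 2 * n₀ - c) * (c₁ : ZMod (p ^ K)) *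
            ((u₀⁻¹ : (ZMod (p ^ K))ˣ) : ZMod (p ^ K)) *
          ((p : ZMod (p ^ K)) ^ c * (u₀ : ZMod (p ^ K))))
        = (p : ZMod (p ^ K)) ^ (n₀ + (K - 2 * n₀ - c) + c) * (c₁ : ZMod (p ^ K)) *
            (((u₀⁻¹ : (ZMod (p ^ K))ˣ) : ZMod (p ^ K)) * (u₀ : ZMod (p ^ K))) := by ring
      _ = (p : ZMod (p ^ K)) ^ (K - n₀) * (c₁ : ZMod (p ^ K)) := by rw [hexp, hu, mul_one]
  -- `m = n - p^{n₀} e₂ ∈ ker Φ ∩ F ⊆ Kum`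
  set m : G := n - p ^ n₀ • e₂ with hm
  have hmF : m ∈ F := F.sub_mem hnF (F.nsmul_mem he₂F _)
  have hΦm : Φ m = 0 := by rw [hm, map_sub, hΦe₂, sub_self]
  have hmKum : m ∈ Kum := hkerΦ m hmF hΦm
  refine ⟨e₁ + e₂, F.add_mem he₁F he₂F, m, hmKum, ?_⟩
  rw [smul_add, hm, hn]
  abel

end Stub

/-! ## §2. `𝓕_can` is cartesian along `E[p^{k+1}] ↪ E[p^{k'+1}]` at every place -/

section Cartesian

variable (W : WeierstrassCurve ℚ) [W.IsElliptic] (p : ℕ) [hp : Fact p.Prime] {k k' : ℕ}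

omit hp in
/-- `p^{k+1} ∣ p^{k'+1}` in `ℤ` for `k ≤ k'`. [folklore] -/
theorem pow_mul_dvd_pow_mul_of_le (hk : k ≤ k') :
    ((p : ℤ) ^ k * (p : ℤ)) ∣ ((p : ℤ) ^ k' * (p : ℤ)) :=
  mul_dvd_mul_right (pow_dvd_pow _ hk) _

/-- **The propagated structure is CARTESIAN along `incl : E[p^{k+1}] ↪ E[p^{k'+1}]` at every place**
(`k ≤ k'`): a class `x ∈ H¹(ℚ_v, E[p^{k+1}])` whose image under `incl_*` lies in
`𝓕_can^{(k')}(v) = im(H¹(ℚ_v, T_pE) → H¹(ℚ_v, E[p^{k'+1}]))` already lies in `𝓕_can^{(k)}(v)`.  Cocycle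
proof (n1011-p13's `isCartesianAt_propagatedSelmerStructure`, two prime-power levels): write
`incl ∘ ξ = π_{k'+1} ∘ η + ∂t`, lift `t` to `T_pE` and absorb `∂t̃` into `η`; then `π_{k'+1} ∘ η` takes
values in `E[p^{k+1}]`, so `η_{k'−k} = 0`, and `η / p^{k'−k}` (the shift `tateDivPow`) is a continuous
crossed homomorphism with `π_{k+1} ∘ (η / p^{k'−k}) = ξ`.  No hypothesis on the place or the curve.
[cite: Sakamoto2024, Def. 3.5 (p. 923)] [cite: MazurRubin2004, Lemma 3.5.3 and Lemma 3.7.1] [cite: Rubin2011, §3.1 (p. 29)] -/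
theorem mem_propagatedSelmerStructure_of_localMap_torsionInclusion_mem (hk : k ≤ k') (v : Place ℚ)
    (x : galoisCohomology ((W.torsionGaloisModule ((p : ℤ) ^ k * (p : ℤ))).toLocal v) 1)
    (hx : DiscreteGaloisModule.localMap (W.torsionInclusion (pow_mul_dvd_pow_mul_of_le p hk)) v x ∈
      propagatedSelmerStructure W p k' v) :
    x ∈ propagatedSelmerStructure W p k v := by
  obtain ⟨ξ, hξ⟩ :=
    oneCocycleClass_surjective ((W.torsionGaloisModule ((p : ℤ) ^ k * (p : ℤ))).toLocal v).toTopRep x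
  subst hξ
  obtain ⟨y, hy⟩ := (mem_propagatedSelmerStructure_iff W p k' v _).mp hx
  obtain ⟨η, hη⟩ := oneCocycleClass_surjective (tateLocalRep W p v).toTopRep y
  subst hη
  rw [tateLocalMap_oneCocycleClass] at hy
  erw [galoisCohomology.map_one_oneCocycleClass] at hy
  obtain ⟨t, ht⟩ := exists_sub_eq_of_oneCocycleClass_eq _ _ _ hy
  -- `ht g`, on underlying points: `(η g)_{k'+1} - ξ g = g t - t`
  have ht' : ∀ g : absoluteGaloisGroup (Place.Completion v),
      TateModule.proj p (k' + 1) (η.1 g) -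
          ((ξ.1 g : geomTorsion W ((p : ℤ) ^ k * (p : ℤ))) : geomPoints W) =
        absGaloisRestrict ℚ (Place.Completion v) g • (t : geomPoints W) - (t : geomPoints W) := by
    intro g
    exact congrArg (fun P : geomTorsion W ((p : ℤ) ^ k' * (p : ℤ)) => (P : geomPoints W)) (ht g)
  -- lift `t` to `T_pE` and absorb its coboundary into `η`
  obtain ⟨tT, htT⟩ := proj_surjective_of_isAlgClosed_holds W p (k' + 1)
    ((mem_geomTorsion_pow_mul_iff W p k' _).mp t.2)
  set η' : contOneCocycles (tateLocalRep W p v).toTopRep :=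
    η - principalCocycle _ tT (continuous_tateLocalRep_apply W p v tT) with hη'
  have hη'apply : ∀ g : absoluteGaloisGroup (Place.Completion v),
      η'.1 g = η.1 g - ((tateLocalRep W p v).toTopRep.ρ g tT - tT) := fun g => rfl
  -- `(η' g)_{k'+1} = ξ g` on points
  have hkey : ∀ g : absoluteGaloisGroup (Place.Completion v),
      TateModule.proj p (k' + 1) (η'.1 g) =
        ((ξ.1 g : geomTorsion W ((p : ℤ) ^ k * (p : ℤ))) : geomPoints W) := by
    intro g
    rw [hη'apply, map_sub, map_sub, ContinuousRep.toTopRep_ρ_apply, tateLocalRep_apply_apply,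
      TateModule.proj_smul_of_distribMulAction, htT, ← ht' g]
    abel
  -- hence `(η' g)_{k'-k} = 0`
  have hk0 : ∀ g : absoluteGaloisGroup (Place.Completion v),
      TateModule.proj p (k' - k) (η'.1 g) = 0 := by
    intro g
    rw [← TateModule.pow_smul_proj_self_add (k + 1) (k' - k) (η'.1 g),
      show k + 1 + (k' - k) = k' + 1 by omega, hkey]
    have hmem := (mem_geomTorsion_iff W _ _).mp (ξ.1 g).2
    have h2 : (((p ^ (k + 1) : ℕ)) : ℤ) •
        ((ξ.1 g : geomTorsion W ((p : ℤ) ^ k * (p : ℤ))) : geomPoints W) = 0 := by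
      rw [Nat.cast_pow, pow_succ]; exact hmem
    rwa [natCast_zsmul] at h2
  -- the divided crossed homomorphism `η'' = η' / p^{k'-k}`
  let f'' : absoluteGaloisGroup (Place.Completion v) → W.tateModule p :=
    fun g => tateDivPow (k' - k) (η'.1 g) (hk0 g)
  have hf''val : ∀ (g : absoluteGaloisGroup (Place.Completion v)) (n : ℕ),
      TateModule.proj p n (f'' g) = TateModule.proj p (n + (k' - k)) (η'.1 g) := fun g n => rfl
  have hcont'' : Continuous f'' :=
    continuous_induced_rng.2
      (continuous_pi fun n => (TateModule.continuous_proj (n + (k' - k))).comp η'.1.continuous)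
  have hcoc'' : ∀ g h : absoluteGaloisGroup (Place.Completion v),
      f'' (g * h) = f'' g + (tateLocalRep W p v).toTopRep.ρ g (f'' h) := by
    intro g h
    apply TateModule.ext
    intro n
    rw [hf''val, map_add, hf''val, ContinuousRep.toTopRep_ρ_apply, tateLocalRep_apply_apply,
      TateModule.proj_smul_of_distribMulAction, hf''val, η'.2 g h, map_add,
      ContinuousRep.toTopRep_ρ_apply, tateLocalRep_apply_apply,
      TateModule.proj_smul_of_distribMulAction]
  let η'' : contOneCocycles (tateLocalRep W p v).toTopRep := ⟨⟨f'', hcont''⟩, hcoc''⟩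
  have hη''apply : ∀ g : absoluteGaloisGroup (Place.Completion v), η''.1 g = f'' g := fun g => rfl
  -- conclude: `x = [ξ] = π_{k+1,*} [η'']`
  refine (mem_propagatedSelmerStructure_iff W p k v _).mpr
    ⟨oneCocycleClass (tateLocalRep W p v).toTopRep η'', ?_⟩
  rw [tateLocalMap_oneCocycleClass]
  congr 1
  apply Subtype.ext
  apply ContinuousMap.ext
  intro g
  apply Subtype.ext
  rw [pushCocycle_apply, coe_tateToTorsion_apply, hη''apply, hf''val,
    show k + 1 + (k' - k) = k' + 1 by omega, hkey g]

/-- **Global form**: a class `x ∈ H¹(ℚ, E[p^{k+1}])` with `incl_* x ∈ H¹_{𝓕_can^{(k')}}(ℚ, E[p^{k'+1}])`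
lies in `H¹_{𝓕_can^{(k)}}(ℚ, E[p^{k+1}])` (cartesian at every place, §2).
[cite: Sakamoto2024, Def. 3.5 (p. 923)] [cite: MazurRubin2004, Lemma 3.5.3] -/
theorem mem_selmerGroup_of_map_torsionInclusion_mem (hk : k ≤ k')
    (x : galoisCohomology (W.torsionGaloisModule ((p : ℤ) ^ k * (p : ℤ))) 1)
    (hx : galoisCohomology.map (W.torsionInclusion (pow_mul_dvd_pow_mul_of_le p hk)) 1 x ∈
      (propagatedSelmerStructure W p k').selmerGroup) :
    x ∈ (propagatedSelmerStructure W p k).selmerGroup := by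
  rw [SelmerStructure.mem_selmerGroup_iff] at hx ⊢
  intro v
  have hv := hx v
  rw [CoreRankZero.localization_map_one_eq] at hv
  exact mem_propagatedSelmerStructure_of_localMap_torsionInclusion_mem W p hk v _ hv

end Cartesian

/-! ## §3. `p = 3`: the short exact sequence between two prime-power levels and a class of FULL
order in `H¹_{𝓕_can}(ℚ, E[3^{k+1}])` from a deeper class -/

section FullOrder

variable (W : WeierstrassCurve ℚ) [W.IsElliptic] {k k' : ℕ}

omit [W.IsElliptic] in
/-- **`0 → E[3^{k+1}] →(incl) E[3^{k'+1}] →(red) E[3^{(k'−k−1)+1}] → 0` is a short exact sequence of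
discrete `Γ_ℚ`-modules** for `k < k'` and any equivariant `red` which is `x ↦ 3^{k+1} x` on points
(surjectivity = divisibility of `E(ℚ̄)`); Milne's `0 → A_m → A_{mn} →ᵐ A_n → 0`.
[cite: MilneADT2006, Ch. I §6, proof of Prop. 6.9] -/
theorem isSES_torsionInclusion_red_of_lt (hk : k < k')
    (red : (W.torsionGaloisModule (((3 : ℕ) : ℤ) ^ k' * ((3 : ℕ) : ℤ))).toContRepresentation →ⁱL
      (W.torsionGaloisModule (((3 : ℕ) : ℤ) ^ (k' - k - 1) * ((3 : ℕ) : ℤ))).toContRepresentation)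
    (hred : ∀ x : geomTorsion W (((3 : ℕ) : ℤ) ^ k' * ((3 : ℕ) : ℤ)),
      ((red x : geomTorsion W (((3 : ℕ) : ℤ) ^ (k' - k - 1) * ((3 : ℕ) : ℤ))) : geomPoints W) =
        (((3 : ℕ) : ℤ) ^ (k' - (k' - k - 1))) • (x : geomPoints W)) :
    IsSES (DiscreteGaloisModule.homOfIntertwining
        (W.torsionInclusion (pow_mul_dvd_pow_mul_of_le 3 hk.le)))
      (DiscreteGaloisModule.homOfIntertwining red) where
  comp_eq_zero := by
    ext P
    have h := (mem_geomTorsion_iff W (((3 : ℕ) : ℤ) ^ k * ((3 : ℕ) : ℤ)) _).mp P.2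
    change ((red (W.torsionInclusion (pow_mul_dvd_pow_mul_of_le 3 hk.le) P) :
      geomTorsion W (((3 : ℕ) : ℤ) ^ (k' - k - 1) * ((3 : ℕ) : ℤ))) : geomPoints W) = 0
    rw [hred, coe_torsionInclusion_apply, show k' - (k' - k - 1) = k + 1 by omega, pow_succ]
    exact h
  injective := fun P Q h => Subtype.ext (congrArg Subtype.val h :)
  exact_mid := fun P hP => by
    have hP' : (((3 : ℕ) : ℤ) ^ k * ((3 : ℕ) : ℤ)) • (P : geomPoints W) = 0 := by
      rw [← pow_succ, show k + 1 = k' - (k' - k - 1) by omega, ← hred]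
      exact congrArg Subtype.val hP
    exact ⟨⟨P, (mem_geomTorsion_iff W _ _).mpr hP'⟩, rfl⟩
  surjective := fun Q => by
    have h3 : (((3 : ℕ) : ℤ) ^ (k' - (k' - k - 1))) ≠ 0 := pow_ne_zero _ (by norm_num)
    obtain ⟨P, hP⟩ := W.zsmul_geomPoints_surjective_of_charZero h3 (Q : geomPoints W)
    have hP' : (((3 : ℕ) : ℤ) ^ (k' - (k' - k - 1))) • P = (Q : geomPoints W) := hP
    have hPmem : P ∈ geomTorsion W (((3 : ℕ) : ℤ) ^ k' * ((3 : ℕ) : ℤ)) := by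
      rw [mem_geomTorsion_iff,
        show (((3 : ℕ) : ℤ) ^ k' * ((3 : ℕ) : ℤ)) =
          (((3 : ℕ) : ℤ) ^ (k' - k - 1) * ((3 : ℕ) : ℤ)) * ((3 : ℕ) : ℤ) ^ (k' - (k' - k - 1)) by
            rw [← pow_succ, ← pow_succ, ← pow_add]; congr 1; omega,
        mul_zsmul, hP']
      exact (mem_geomTorsion_iff W _ _).mp Q.2
    refine ⟨⟨P, hPmem⟩, Subtype.ext ?_⟩
    change ((red ⟨P, hPmem⟩ : geomTorsion W (((3 : ℕ) : ℤ) ^ (k' - k - 1) * ((3 : ℕ) : ℤ))) :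
      geomPoints W) = (Q : geomPoints W)
    rw [hred]
    exact hP'

/-- **A class of FULL order `3^{k+1}` in `H¹_{𝓕_can}(ℚ, E[3^{k+1}])` from a deeper class.**  Under
surj(3) (`E(ℚ̄)[3^∞]^{Γ_ℚ} = 0`), for `k < k'`: if `y ∈ H¹_{𝓕_can^{(k')}}(ℚ, E[3^{k'+1}])` has additive
order divisible by `3^{k+1}`, then `z = (ord y / 3^{k+1}) • y` has order `3^{k+1}`, is killed by `red_*`
(`incl′_* red_* = 3^{k+1}`, `incl′_*` injective), hence `z = incl_* x` by the exactness of `H¹` along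
`0 → E[3^{k+1}] → E[3^{k'+1}] → E[3^{k'−k}] → 0`, and `x ∈ H¹_{𝓕_can^{(k)}}(ℚ, E[3^{k+1}])` (cartesian, §2)
has order exactly `3^{k+1}` (`incl_*` injective).  This is the one consequence of Mazur–Rubin
Thm. 4.1.13 (i) (`H¹_{𝓕}(ℚ, T/𝔪^k) ≅ R ⊕ H¹_{𝓕^*}`) that the stub-from-orders argument needs.
[cite: MazurRubin2004, Thm. 4.1.13 (i), Lemma 3.5.3] [cite: MilneADT2006, Ch. I §6] -/
theorem exists_mem_selmerGroup_addOrderOf_eq_of_deep (hk : k < k')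
    (hsurj : W.HasSurjectiveModNGaloisRep ((3 : ℕ) : ℤ))
    {y : galoisCohomology (W.torsionGaloisModule (((3 : ℕ) : ℤ) ^ k' * ((3 : ℕ) : ℤ))) 1}
    (hy : y ∈ (propagatedSelmerStructure W 3 k').selmerGroup)
    (hyord : 3 ^ (k + 1) ∣ addOrderOf y) :
    ∃ x ∈ (propagatedSelmerStructure W 3 k).selmerGroup, addOrderOf x = 3 ^ (k + 1) := by
  haveI : Fact (Nat.Prime 3) := ⟨Nat.prime_three⟩
  -- `z = (ord y / 3^{k+1}) • y` has order `3^{k+1}`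
  have hy0 : addOrderOf y ≠ 0 :=
    ne_zero_of_dvd_ne_zero (pow_ne_zero _ three_ne_zero)
      (addOrderOf_dvd_of_nsmul_eq_zero (Transport.pow_succ_nsmul_galoisCohomology W k' y))
  set z := (addOrderOf y / 3 ^ (k + 1)) • y with hz
  have hzord : addOrderOf z = 3 ^ (k + 1) := addOrderOf_nsmul_addOrderOf_sub hy0 hyord
  have hzmem : z ∈ (propagatedSelmerStructure W 3 k').selmerGroup := AddSubgroup.nsmul_mem _ hy _
  -- `red : E[3^{k'+1}] → E[3^{(k'-k-1)+1}]`, `x ↦ 3^{k+1} x`; `red_* z = 0`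
  obtain ⟨red, hred⟩ := exists_torsionReduction_three W (k' - k - 1) k'
  have hΓ : ∀ P : geomTorsion W (((3 : ℕ) : ℤ) ^ k' * ((3 : ℕ) : ℤ)),
      (∀ σ : absoluteGaloisGroup ℚ, σ • P = P) → P = 0 :=
    Transport.geomTorsion_eq_zero_of_fixed_of_surj W hsurj k'
  have hle : k' - k - 1 ≤ k' := by omega
  have hredz : galoisCohomology.map red 1 z = 0 := by
    refine (injective_iff_map_eq_zero _).1 (Transport.map_torsionInclusion_injective W hle hΓ) _ ?_
    rw [Transport.map_torsionInclusion_map_red W hle red hred z,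
      show k' - (k' - k - 1) = k + 1 by omega, ← hzord, addOrderOf_nsmul_eq_zero]
  -- exactness: `z = incl_* x`
  obtain ⟨x, hx⟩ : ∃ x, galoisCohomology.map
      (W.torsionInclusion (pow_mul_dvd_pow_mul_of_le 3 hk.le)) 1 x = z :=
    (isSES_torsionInclusion_red_of_lt W hk red hred).exists_map_one_eq_of_map_one_eq_zero z hredz
  refine ⟨x, ?_, ?_⟩
  · exact mem_selmerGroup_of_map_torsionInclusion_mem W 3 hk.le x (hx ▸ hzmem)
  · rw [← addOrderOf_injective _ (Transport.map_torsionInclusion_injective W hk.le hΓ) x]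
    change addOrderOf (galoisCohomology.map
      (W.torsionInclusion (pow_mul_dvd_pow_mul_of_le 3 hk.le)) 1 x) = _
    rw [hx, hzord]

end FullOrder

end Summit.BirchSwinnertonDyer.BirchSwinnertonDyer.Theorems.KimAtThreeShallowEqDeepStubOfOrder

end
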